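import Summits.RiemannHypothesis.RiemannHypothesis.Theorems.SignConeSignConeOscillatoryTwoBump
import Summits.RiemannHypothesis.RiemannHypothesis.Theorems.SignConeSignConeOscillatoryStatus

/-!
# The oscillatory node-nonnegative class is non-empty exactly for cutoffs `a > (log 2)/2`
(route `SignCone`, item stmt-RiemannHypothesis-16302 `SignConeOscillatory`; HELPER file, `--supports`)

`SignConeSignConeOscillatoryStatus.lean` shows that for `0 < a ≤ (log 2)/2` NO family of Weil tests supported in
`[-a, a]` is oscillatory (`not_oscillatory_of_le_log_two_half`), and `SignConeSignConeOscillatoryWitness.lean` gives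
one oscillatory node-nonnegative test at `a = 1/2`. Here the threshold is made sharp with the two-bump witness of
`SignConeSignConeOscillatoryTwoBump.lean` placed in the FIRST node gap `(log 2, log 3)`:
`w = φ(· + c/2) - φ(· - c/2)`, `φ = WeilContinuous.moll N` of radius `ρ = 1/(N+1) ≤ 1/12`, `c = log 2 + 2ρ`,
so that `w ⋆ w̃` vanishes at every node `log m` (`m ≥ 2`), is negative at `c ≥ log 2`, and `w` is supported in
`[-(log 2)/2 - 2ρ, (log 2)/2 + 2ρ] ⊆ [-a, a]` once `2ρ ≤ a - (log 2)/2`.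

* `exists_oscillatory_nodeVanishing_test` — for every `a > (log 2)/2` one Weil test `g` supported in `[-a, a]` whose
  autocorrelation vanishes at all nodes and has negative real part at some `|t| ≥ log 2`;
* `oscillatoryClass_nonempty_iff` — for `a > 0`: the hypotheses of `SignConeOscillatory` at cutoff `a` are
  satisfiable (by some `k`, `g : Fin k → ℝ → ℂ`) iff `(log 2)/2 < a`. So the content of the crux starts exactly at
  the first node, and every cutoff-restricted rung `a ≤ b` with `b > (log 2)/2` (e.g. the certified
  `signConeOscillatory_upTo_certb`, `b = 563/1024`) is a statement about a non-empty class.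
-/

noncomputable section

-- `Summit.RiemannHypothesis.RiemannHypothesis.…` repeats a namespace component by design (D-0017 layout).
set_option linter.dupNamespace false

open scoped BigOperators ComplexConjugate Topology
open Complex MeasureTheory Set Filter

namespace Summit.RiemannHypothesis.RiemannHypothesis.Theorems.SignCone

open Literature.NumberTheory.LFunctions
open Summit.RiemannHypothesis.RiemannHypothesis.Theorems.RuelleBandCofiniteCriticalLine

/-- **First-gap parameters.** For `a > (log 2)/2` there is a bump index `N` (radius `ρ = 1/(N+1)`) with
`2ρ ≤ a - (log 2)/2` and `ρ ≤ 1/12` (so `4ρ ≤ 1/3 ≤ log 3 - log 2`); then `c := log 2 + 2ρ` lies in the first node gap at distance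
`≥ 2ρ` from every node `log m`, `m ≥ 2`. [folklore] -/
theorem exists_firstGap_parameters {a : ℝ} (ha : Real.log 2 / 2 < a) :
    ∃ N : ℕ, 2 * (WeilContinuous.bump N).rOut ≤ a - Real.log 2 / 2 ∧
      (∀ m : ℕ, 2 ≤ m →
        2 * (WeilContinuous.bump N).rOut ≤ |Real.log m - (Real.log 2 + 2 * (WeilContinuous.bump N).rOut)|) ∧
      (∀ m : ℕ, 2 ≤ m → 2 * (WeilContinuous.bump N).rOut ≤ Real.log m) := by
  obtain ⟨N₀, hN₀⟩ := exists_nat_gt (2 / (a - Real.log 2 / 2))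
  have hgap : 0 < a - Real.log 2 / 2 := by linarith
  refine ⟨max 11 N₀, ?_, ?_, ?_⟩
  all_goals
    have hρ : (WeilContinuous.bump (max 11 N₀)).rOut = 1 / (((max 11 N₀ : ℕ) : ℝ) + 1) :=
      WeilContinuous.bump_rOut _
    have h9 : (11 : ℝ) ≤ ((max 11 N₀ : ℕ) : ℝ) := by exact_mod_cast le_max_left 11 N₀
    have hN : (N₀ : ℝ) ≤ ((max 11 N₀ : ℕ) : ℝ) := by exact_mod_cast le_max_right 11 N₀
    have hρ10 : (WeilContinuous.bump (max 11 N₀)).rOut ≤ 1 / 12 := by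
      rw [hρ]
      exact one_div_le_one_div_of_le (by norm_num) (by linarith)
  · -- `2ρ ≤ a - (log 2)/2` from `N + 1 > 2 / (a - (log 2)/2)`
    rw [hρ]
    have h1 : 2 / (a - Real.log 2 / 2) < ((max 11 N₀ : ℕ) : ℝ) + 1 := by linarith
    rw [div_lt_iff₀ hgap] at h1
    rw [show 2 * (1 / (((max 11 N₀ : ℕ) : ℝ) + 1)) = 2 / (((max 11 N₀ : ℕ) : ℝ) + 1) by ring,
      div_le_iff₀ (by positivity)]
    linarith
  · intro m hm
    have hlog32 : (1 : ℝ) / 3 ≤ Real.log 3 - Real.log 2 := by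
      rw [← Real.log_div (by norm_num) (by norm_num)]
      have h := Real.one_sub_inv_le_log_of_pos (x := (3 : ℝ) / 2) (by norm_num)
      norm_num at h ⊢
      linarith
    rcases Nat.lt_or_ge m 3 with hm3 | hm3
    · have hm2 : m = 2 := by omega
      subst hm2
      rw [show Real.log (2 : ℕ) = Real.log 2 by norm_num, abs_of_nonpos (by linarith [(WeilContinuous.bump (max 11 N₀)).rOut_pos])]
      linarith
    · have hm3' : (3 : ℝ) ≤ m := by exact_mod_cast hm3
      have hlm : Real.log 3 ≤ Real.log m := Real.log_le_log (by norm_num) hm3'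
      rw [abs_of_nonneg (by linarith)]
      linarith
  · intro m hm
    have hm' : (2 : ℝ) ≤ m := by exact_mod_cast hm
    have hlm : Real.log 2 ≤ Real.log m := Real.log_le_log (by norm_num) hm'
    linarith [Real.log_two_gt_d9]

/-- **For every cutoff `a > (log 2)/2` the oscillatory node-nonnegative class is non-empty with `k = 1`**: a Weil
test `g` supported in `[-a, a]` whose autocorrelation `g ⋆ g̃` VANISHES at every node `log m` (`m ≥ 2`) and has
negative real part at some `t ≥ log 2` (the two-bump witness in the first node gap). [folklore] -/
theorem exists_oscillatory_nodeVanishing_test {a : ℝ} (ha : Real.log 2 / 2 < a) :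
    ∃ g : ℝ → ℂ, IsWeilTest g ∧ tsupport g ⊆ Icc (-a) a ∧
      (∀ m : ℕ, 2 ≤ m → weilConv g (weilReflect g) (Real.log m) = 0) ∧
      ∃ t : ℝ, Real.log 2 ≤ |t| ∧ (weilConv g (weilReflect g) t).re < 0 := by
  obtain ⟨N, hρa, hnode, hlogm⟩ := exists_firstGap_parameters ha
  have hρ := (WeilContinuous.bump N).rOut_pos
  set ρ := (WeilContinuous.bump N).rOut with hρdef
  set c : ℝ := Real.log 2 + 2 * ρ with hcdef
  have hlog2 : (0 : ℝ) < Real.log 2 := Real.log_pos (by norm_num)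
  have hc0 : 0 ≤ c := by rw [hcdef]; linarith
  have hρc : 2 * ρ ≤ c := by rw [hcdef]; linarith
  refine ⟨fun u => WeilContinuous.moll N (u + c / 2) - WeilContinuous.moll N (u - c / 2), isWeilTest_twoBump N c,
    (tsupport_twoBump_subset N hc0).trans (Icc_subset_Icc ?_ ?_), fun m hm =>
      weilConv_twoBump_eq_zero N hc0 (hlogm m hm) (hnode m hm), c, ?_, re_weilConv_twoBump_neg N hρc⟩
  · rw [hcdef]; linarith
  · rw [hcdef]; linarith
  · rw [abs_of_nonneg hc0, hcdef]; linarith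

/-- **The content threshold of the crux is exactly the first node.** For `a > 0`, the hypotheses of
`SignConeOscillatory` at cutoff `a` — a finite family of Weil tests supported in `[-a, a]` whose autocorrelation sum
is node-nonnegative and has negative real part somewhere on `|t| ≥ log 2` — are satisfiable iff `(log 2)/2 < a`
(`→`: `not_oscillatory_of_le_log_two_half`; `←`: `exists_oscillatory_nodeVanishing_test` with `k = 1`). [folklore] -/
theorem oscillatoryClass_nonempty_iff {a : ℝ} (ha : 0 < a) :
    (∃ (k : ℕ) (g : Fin k → ℝ → ℂ), (∀ i, IsWeilTest (g i) ∧ tsupport (g i) ⊆ Icc (-a) a) ∧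
      (∀ n : ℕ, 2 ≤ n → 0 ≤ ((fun t => ∑ i, weilConv (g i) (weilReflect (g i)) t) (Real.log n)).re) ∧
      ∃ t : ℝ, Real.log 2 ≤ |t| ∧ ((fun t => ∑ i, weilConv (g i) (weilReflect (g i)) t) t).re < 0) ↔
    Real.log 2 / 2 < a := by
  constructor
  · rintro ⟨k, g, hg, -, hosc⟩
    by_contra hle
    exact not_oscillatory_of_le_log_two_half ha (not_lt.1 hle) g (fun i => (hg i).1) (fun i => (hg i).2) hosc
  · intro hlt
    obtain ⟨g, hg, hsupp, hnode, t, ht, hneg⟩ := exists_oscillatory_nodeVanishing_test hlt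
    refine ⟨1, fun _ => g, fun _ => ⟨hg, hsupp⟩, fun n hn => ?_, t, ht, ?_⟩
    · simp [hnode n hn]
    · simpa using hneg

/-- The same over Mathlib primitives (the verbatim hypotheses of the route decl `SignConeOscillatory` at cutoff
`a`): satisfiable iff `(log 2)/2 < a`. [folklore] -/
theorem signConeOscillatory_hypotheses_satisfiable_iff {a : ℝ} (ha : 0 < a) :
    (∃ (k : ℕ) (g : Fin k → ℝ → ℂ), (∀ i, (ContDiff ℝ ((⊤ : ℕ∞) : WithTop ℕ∞) (g i) ∧ HasCompactSupport (g i)) ∧ tsupport (g i) ⊆ Set.Icc (-a) a) ∧ let F : ℝ → ℂ := fun t => ∑ i, MeasureTheory.convolution (g i) (fun u => (starRingEnd ℂ) ((g i) (-u))) (ContinuousLinearMap.mul ℂ ℂ) MeasureTheory.MeasureSpace.volume t; (∀ n : ℕ, 2 ≤ n → 0 ≤ (F (Real.log n)).re) ∧ ∃ t : ℝ, Real.log 2 ≤ |t| ∧ (F t).re < 0) ↔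
    Real.log 2 / 2 < a :=
  oscillatoryClass_nonempty_iff ha

end Summit.RiemannHypothesis.RiemannHypothesis.Theorems.SignCone

end
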